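import Summits.Ventures.PackingBounds.ThreePointCert.K17d14AggG1
import Summits.Ventures.PackingBounds.ThreePointCert.K17d14AggG2
import Summits.Ventures.PackingBounds.ThreePointCert.K17d14AggG3
import Summits.Ventures.PackingBounds.ThreePointCert.K17d14AggP
import Summits.Ventures.PackingBounds.ThreePointCert.CheckFKS

/-!
# κ(17) ≤ 11072: kernel validation (Kronecker substitution) of the three-point part (120 weight vectors)

Framing: lottery ticket; floor = certified bounds/negative ranges. Venture `PackingBounds` (cell
`pub-packcert`), three-point SDP family, kissing column. Integer data / kernel checks of a feasible point of the
Bachoc–Vallentin semidefinite program (n = 17, s = 1/2, three-point matrix degree 14, two-point (Gegenbauer) part to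
degree L = 28, Bachoc–Vallentin multiplier set = cell mode sym2; exact rational certificate `sdp-n17-d14-s1-2-sym2-a28-hyb8dd-j155376.json`
(sha256 27a00590c8977ad2de976a2a51d7a757e2063a21586ec162be43db2f1c3b3d1d) of the sdp seat's hybrid pipeline, verified by the cell's two exact verifiers), converted by
`cert2lean_g9.py` (lp gen 9; S = 82) into the units of the kernel checker `ThreePointCert.Check` + `CheckSym2` with the
record degree field set to L = 28 (the checker's degree enters only the unit `W = 2^d·d!` and the side conditions, so a
(d, L) certificate is a `Cert3` of degree L); symmetry-adapted PARTS (S₃/S₂ isotypic bases of short polynomials) with coarse factor COLUMNS, validated by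
Kronecker substitution `ThreePointCert.CheckKSP` (`sosCheckKSParts`: the claimed expansion and `Σ_parts Σ_k col_k²` compared at `(2^w, 2^{wD}, 2^{wD²})`); three-point part by `CheckFKS`;
split check of (ii') `ThreePointCert.CheckSym2Split`. Emitter `emitlean_ks3.py` (lp gen 10; expansions `4^k • Σ_parts pᵀ(L′L′ᵀ)p` lifted by `SoundNN.boxNonneg_smul`). Generated file: plain lists of integers / monomials.
-/

namespace Summit.Ventures.PackingBounds.ThreePointCert.K17d14

open Literature.Geometry.DiscreteGeometry Literature.Geometry.DiscreteGeometry.PolyCert PolyCert.SPoly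

set_option maxRecDepth 100000 in
set_option maxHeartbeats 0 in
/-- The claimed expansion `eFP` of the three-point part `FI` IS `FPolyG` — Kronecker-substitution check at `(2^326, 2^(326·15), 2^(326·15²))` against the ghost `gF` (kernel; 120 weight vectors, 1856 terms). -/
theorem vF : fCheckKS 326 15 K17d14.cert.n K17d14.cert.d K17d14.cert.F K17d14.eFP = true := by
  decide +kernel

end Summit.Ventures.PackingBounds.ThreePointCert.K17d14
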